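import Literature.Barriers.AnomalousDissipation.IntermittentDissipationThm27Steps
import Literature.Analysis.FluidPDE.EnergyFluxMollifiedTest
import Literature.Analysis.FluidPDE.NovackFourThirdsFourFifthsProofs
import HarnessLib

/-!
# De Rosa–Isett's Thm. 2.7: the regularised pairing converges (discharge of `DeRosaIsett2024_s51_mollifiedLimit`)

Sorry-free proof `DeRosaIsett2024_s51_mollifiedLimit_holds` of the second named step fact of
`Literature.Barriers.AnomalousDissipation.IntermittentDissipationThm27Steps` (De Rosa–Isett,
ARMA 248 (2024) = arXiv:2212.08176, §5.1: "Clearly, `⟨D^v_ε - D^v ∗ ρ_ε, φ⟩ → 0`"), in the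
tree's symmetric Duchon–Robert form: for a distributional Euler solution `(v, p)` on
`T^d × (0,T)` with `p ∈ L^{3/2}`, `v ∈ L^q(0,T; B^θ_{q,∞})`, `q ∈ [3,∞)`, and `D` its
Duchon–Robert distribution (`Torus.HasLocalEnergyBalance T 0 v p 0 D`), `D(φ ⋆ₓ k_ε) → D(φ)` as
`ε → 0⁺` for every test function `φ` supported in `(0,T)`, `k_ε = Torus.kernel ε`.

## Proof

On test functions `D` is the local energy flux `𝓔(ψ) = ∫₀ᵀ∫ ½|v|²∂ₜψ + (½|v|² + p)⟪v,∇ψ⟫`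
(`Torus.energyFluxFunctional`, `HasLocalEnergyBalance.energyFluxFunctional_eq`). The slice-wise
mollification `φ ⋆ₓ k_ε` of a test function is a test function
(`Torus.isSpaceTimeTestIoo_kernel_conv`, `Literature.Analysis.FluidPDE.EnergyFluxMollifiedTest`),
with `∂ₜ(φ ⋆ₓ k_ε) = (∂ₜφ) ⋆ₓ k_ε` and `∇(φ ⋆ₓ k_ε) = (∇φ) ⋆ₓ k_ε`
(`Torus.timeDeriv_kernel_conv`, `Torus.gradient_convolution`); both converge uniformly on
`[0,T] × T^d` by uniform continuity of the test data on that compact set and Mathlib's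
`dist_convolution_le` (Evans, App. C.4, Thm. 7 (iii)); and `𝓔` is Lipschitz in the sup norms of
`(∂ₜψ, ∇ψ)` with constant `∫∫ ½|v|² + (½|v|² + |p|)|v| < ∞`
(`Torus.abs_energyFluxFunctional_sub_le`, Hölder `3, 3/2`). The glue
`L^q_t B^θ_{q,∞} ⊂ L³_{t,x}` for `q ≥ 3` on the finite measure space `(0,T) × T^d` is
`Torus.lintegral_pow_three_lt_top_of_memLpBesovSup` (same file).

## References

* L. De Rosa, P. Isett, Arch. Ration. Mech. Anal. 248 (2024), Paper No. 11 = arXiv:2212.08176,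
  §5.1. [DeRosaIsett2024]
* L. C. Evans, *Partial Differential Equations*, 2nd ed. (2010), App. C.4, Thm. 7. [Evans2010]
-/

open MeasureTheory Set Filter Metric Function
open _root_.Topology
open scoped ENNReal NNReal Convolution InnerProductSpace RealInnerProductSpace

noncomputable section

namespace Literature.Barriers.AnomalousDissipation



/-! ## The discharge -/

section Discharge

open Literature.Analysis Literature.Analysis.FunctionSpaces Literature.Analysis.FluidPDE

/-- **De Rosa–Isett 2024, §5.1 ("Clearly, `⟨D^v_ε - D^v ∗ ρ_ε, φ⟩ → 0`"), discharged**: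
`D(φ ⋆ₓ k_ε) → D(φ)` as `ε → 0⁺` for the Duchon–Robert distribution `D` of a distributional Euler
solution `(v,p)`, `v ∈ L^q_tB^θ_{q,∞}`, `q ∈ [3,∞)`, `p ∈ L^{3/2}`, and a test function `φ`
supported in `(0,T)`. Proof: on tests `D` is the local energy flux `𝓔`; the mollified test is a
test, its test data `(∂ₜ, ∇)(φ ⋆ₓ k_ε) = (∂ₜφ, ∇φ) ⋆ₓ k_ε` converge uniformly on `[0,T] × T^d`,
and `𝓔` is Lipschitz in the test data. [cite: DeRosaIsett2024, §5.1] -/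
theorem DeRosaIsett2024_s51_mollifiedLimit_holds : DeRosaIsett2024_s51_mollifiedLimit := by
  intro d _ _ T hT v p hsol hp q hq hq' θ hθ hv D hD φ hφ
  set μT := (volume.restrict (Ioo 0 T)).prod (volume : Measure (UnitAddTorus d)) with hμT
  have hvm : AEStronglyMeasurable (uncurry v) μT := Torus.aestronglyMeasurable_uncurry_prod hsol.1
  have hpm : AEStronglyMeasurable (uncurry p) μT := Torus.aestronglyMeasurable_uncurry_prod hsol.2.2.1
  have hv3 : ∫⁻ t in Ioo 0 T, ∫⁻ x, ‖v t x‖ₑ ^ (3 : ℕ) < ⊤ :=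
    Torus.lintegral_pow_three_lt_top_of_memLpBesovSup hq hq' hvm hv
  have hDE : ∀ ψ : ℝ → UnitAddTorus d → ℝ, Torus.IsSpaceTimeTestIoo T ψ →
      D ψ = Torus.energyFluxFunctional T v p ψ := fun ψ hψ => (hD.energyFluxFunctional_eq hψ).symm
  -- the test data and their moduli of continuity
  obtain ⟨-, hdt, hgr, -⟩ := hφ.isSpaceTimeTest.isSmoothSpaceTimeOn_derived
  have hdtc : Continuous (uncurry (Torus.timeDeriv φ)) :=
    Torus.continuous_uncurry_of_continuous_stLift hφ.isSpaceTimeTest.timeDeriv.1.continuous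
  have hgrc : Continuous (uncurry fun t => Torus.gradient (φ t)) := by
    have h := hgr
    unfold Torus.IsSmoothSpaceTimeOn at h
    rw [univ_prod_univ, contDiffOn_univ] at h
    exact Torus.continuous_uncurry_of_continuous_stLift h.continuous
  rw [Metric.tendsto_nhdsWithin_nhds]
  intro η hη
  set C₀ : ℝ := ∫ z, (2⁻¹ * ‖v z.1 z.2‖ ^ 2 + (2⁻¹ * ‖v z.1 z.2‖ ^ 2 + ‖p z.1 z.2‖) * ‖v z.1 z.2‖)
    ∂μT with hC₀
  have hC₀0 : 0 ≤ C₀ := integral_nonneg fun z => by positivity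
  set η' : ℝ := η / (2 * (C₀ + 1)) with hη'
  have hη'0 : 0 < η' := by positivity
  obtain ⟨δ₁, hδ₁, hmod₁⟩ := Torus.exists_forall_dist_lt_of_continuous_uncurry hdtc T hη'0
  obtain ⟨δ₂, hδ₂, hmod₂⟩ := Torus.exists_forall_dist_lt_of_continuous_uncurry hgrc T hη'0
  refine ⟨min (min δ₁ δ₂) (1 / 4), by positivity, fun ε hε hdist => ?_⟩
  have hε0 : 0 < ε := hε
  have hεlt : ε < min (min δ₁ δ₂) (1 / 4) := by
    rwa [Real.dist_eq, sub_zero, abs_of_pos hε0] at hdist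
  have hε4 : ε ≤ 1 / 4 := (hεlt.trans_le (min_le_right _ _)).le
  have hεδ₁ : ε ≤ δ₁ := (hεlt.trans_le ((min_le_left _ _).trans (min_le_left _ _))).le
  have hεδ₂ : ε ≤ δ₂ := (hεlt.trans_le ((min_le_left _ _).trans (min_le_right _ _))).le
  have hk : Integrable (Torus.kernel (d := d) ε) volume :=
    (Torus.continuous_kernel hε0 hε4).integrable_unitAddTorus
  -- the mollified test function
  rw [Torus.conv_kernel_comm (Torus.kernel ε) φ]
  have hψε : Torus.IsSpaceTimeTestIoo T (fun t => Torus.kernel ε ⋆ φ t) :=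
    Torus.isSpaceTimeTestIoo_kernel_conv hφ hk
  rw [hDE _ hψε, hDE _ hφ, Real.dist_eq]
  -- the test data of the mollified test are uniformly close
  have hdt' : ∀ t ∈ Icc 0 T, ∀ x, |Torus.timeDeriv (fun t => Torus.kernel ε ⋆ φ t) t x -
      Torus.timeDeriv φ t x| ≤ η' := by
    intro t ht x
    rw [Torus.timeDeriv_kernel_conv hφ.isSpaceTimeTest hk, ← Real.dist_eq]
    refine Torus.dist_kernel_conv_le (g := Torus.timeDeriv φ t) ?_ hη'0.le (fun a b hab => ?_) hε0 hεδ₁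
      hε4 x
    · exact (hdtc.comp (Continuous.prodMk_right t)).aestronglyMeasurable
    · exact (hmod₁ t ht a b hab).le
  have hgr' : ∀ t ∈ Icc 0 T, ∀ x, ‖Torus.gradient ((fun t => Torus.kernel ε ⋆ φ t) t) x -
      Torus.gradient (φ t) x‖ ≤ η' := by
    intro t ht x
    have hφt : Torus.IsSmooth (φ t) := hφ.isSpaceTimeTest.isSmooth_slice t
    rw [show (fun t => Torus.kernel ε ⋆ φ t) t = Torus.kernel ε ⋆ φ t from rfl,
      Torus.gradient_convolution hk hφt x, ← dist_eq_norm]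
    refine Torus.dist_kernel_conv_le (g := fun y => Torus.gradient (φ t) y) ?_ hη'0.le
      (fun a b hab => ?_) hε0 hεδ₂ hε4 x
    · exact (hgrc.comp (Continuous.prodMk_right t)).aestronglyMeasurable
    · exact (hmod₂ t ht a b hab).le
  calc |Torus.energyFluxFunctional T v p (fun t => Torus.kernel ε ⋆ φ t) -
        Torus.energyFluxFunctional T v p φ|
      ≤ η' * C₀ := Torus.abs_energyFluxFunctional_sub_le hvm hv3 hpm hp hψε.isSpaceTimeTest
          hφ.isSpaceTimeTest hdt' hgr'
    _ < η := by
        rw [hη', div_mul_eq_mul_div, div_lt_iff₀ (by positivity)]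
        nlinarith

end Discharge

end Literature.Barriers.AnomalousDissipation

end
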